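import Summits.BirchSwinnertonDyer.BirchSwinnertonDyer.Theorems.AdditiveBranchIMCMultLowerCruxShape
import Summits.BirchSwinnertonDyer.Rank1Residual.AdditivePotMult.PotMultCongruentPartnerEPW
import HarnessLib

/-!
# Crux `MultLower` (item 19359) / child `MultLambdaLower` (item 19590) BY NAME FROM ROW DATA:
# the record-and-budget currency of cell n1011 (Kato half + first unit index + `b ≤ λ`), and the
# Emerton–Pollack–Weston RANK-PARTNER supply of the budget, in the K1 route's names

Cell `bsd-addord`, seat `bsd-addord-k1-c4` (D-0074 row B3), gen 3. Sequel of
`AdditiveBranchIMCMultLower{CruxShape,Congruence,CongruenceCert,CongruenceModels}`; the (M) twin of k1-c2's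
`AdditiveBranchIMCGordTwoRankZeroIrreducible.gordTwoRankZeroOffCaseOne_of_facts_of_routeG`. HONEST FRAMING:
theorems only; every published input is a named-fact binder (`hKW` = the Kato/Wuthrich half-eigen reading,
`hEPW` = `EmertonPollackWeston2006.muLambdaAlg_transfer_of_torsionIso_potOrd` — EPW Thm. 3.3.2/3.3.3 (2) for
additive potentially ordinary / potentially multiplicative congruent pairs, vendored by k1-c2 gen 3 — and the
route's facts); the per-row data are displayed binders, never asserted; nothing is booked; BSD is not proved.

WHY THIS FILE. The K1 items 19359/19590 are stated class-wide; the tree's per-pair instruments on cell (M)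
live in cell n1011's `AdditivePotMult/PotMult{BudgetRankZeroEnds,CongruentPartnerMainConjecture,CongruentPartnerEPW}`
in the currency «X4(M) ∧ surj(p), a RECORD `MultFirstUnitIndexAt W p b` / `MultOddFirstUnitIndexAt W p b`
(the first `p`-adic unit coefficient of the Néron-normalised branch series of the multiplicative twist model
sits at index `b`: then Kato gives `λ ≤ b`) and a BUDGET `BudgetLeLambdaAt p W b` (`b ≤ λ` for every
cyclotomic dual datum with `μ = 0`)» — record + budget ⟹ the full branch main conjecture at the pair, i.e.
`QuadraticBranchLowerDivisibilityAt V p` at every twist model (`…_of_budget'`) and the lower half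
`MissingLowerBoundAt W p` (`…_of_budget`). The budget is FREE up to the rank (`budgetLeLambdaAt_of_le_mordellWeilRank`)
and is otherwise supplied by a mod-`p` CONGRUENT PARTNER of Mordell–Weil rank `≥ r₁` through the cited EPW
algebraic transfer (`budgetLeLambdaAt_of_epw_of_partnerRank`: `b ≤ r₁ + Σ_{w∈Σ₀}(δ(E₁,w) − δ(E,w))`) — the
road whose reach k1-c2 gen 3 measured (kit j253895: a clean rank-2 partner inside Cremona's table for 226 of
the 445 pure content (M) rows at `p = 5`, 14/77 at `7`), as opposed to the UNIT-partner road of this seat's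
`…Congruence*` files (EPW Cor. 5.1.4 analytic transfer; reach ≤ 10 of 542, kit j254129). This file states
the K1 items BY NAME modulo exactly that row data, so that a per-pair certificate «(b, record, budget)» or
«(b, record, rank-`r₁` partner, lines, `E[p] ≃ E₁[p]`, `Σ₀`)» is visibly an instance of 19590 / of the
rank-`0` half of 19359 at the pair.

* §1 `multLambdaLower_of_katoHalf_of_rowData` — item 19590 BY NAME ⟸ `hKW` + per (M) pair of analytic rank
  `≤ 1`: EITHER (X4(M), `ρ̄` onto, some `b` with record and budget) OR the raw Λ-adic input.
* §2 `lowerHalfM_of_facts_of_katoHalf_of_rowData` — the registered `stub_rankZero` = `N10.LowerHalfM` ⟸ the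
  route's facts + `hKW` + the same datum on CONTENT rank-`0` rows only.
* §3 `multLower_of_facts_of_katoHalf_of_rowData_of_rankOneInputs` — the parent `MultLower` BY NAME ⟸ §1's
  data + the rank-`1` inputs of the §C split (Schneider + branch `p`-adic Gross–Zagier on (M)).
* §4 `missingLowerBoundAt_rankZero_cellM_surj_of_epw_of_multPartner` — the EPW rank-partner supply composed
  into 19359's currency: X4(M) ∧ surj ∧ `r_an = 0` + record at `b` + an X4(M) ∧ surj partner of rank `≥ r₁`
  + lines + `E[p] ≃ E₁[p]` (line-respecting) + `Σ₀` + `b ≤ r₁ + Σ(δ₁ − δ)` ⟹ `MissingLowerBoundAt W p`.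

References: Kato 2004 Thm. 12.5 (4)/17.4 [Kato2004Asterisque]; Emerton–Pollack–Weston 2006 Thm. 3.3.2,
3.3.3, Lemma 5.1.5, Cor. 3.2.5 [EmertonPollackWeston2006]; Greenberg–Vatsal 2000 (1)–(2), Prop. (2.4)
[GreenbergVatsal2000]; Greenberg LNM 1716 §3 Lemma 3.1 [GreenbergLNM1716]; Delbourgo 1998 Prop. 4
[Delbourgo1998]; Pal 2012 Thm. 3.2 [Pal2012]; Delbourgo 2002 (A)/(B) [Delbourgo2002]; Miller 2011 Def. 1.1
[Miller2011LMS].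
-/

set_option autoImplicit false
set_option linter.dupNamespace false

noncomputable section

open scoped Classical MatrixGroups ModularForm NumberField

open CongruenceSubgroup WeierstrassCurve NumberField IsDedekindDomain Field
  Literature.NumberTheory.EllipticCurves
  Literature.NumberTheory.EllipticCurves.ModularForms
  Literature.NumberTheory.EllipticCurves.Rank1Residual
  Literature.NumberTheory.EllipticCurves.Rank1Residual.Typed
  Literature.NumberTheory.EllipticCurves.GreenbergSelmer
  Literature.NumberTheory.EllipticCurves.GreenbergVatsal2000
  Literature.NumberTheory.EllipticCurves.EmertonPollackWeston2006
  Literature.NumberTheory.GaloisRepresentations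

namespace Summit.BirchSwinnertonDyer.BirchSwinnertonDyer.Theorems.AdditiveBranchIMCMultLowerBudget

open Summit.BirchSwinnertonDyer.Rank1Residual
open Summit.BirchSwinnertonDyer.Rank1Residual.Additive
open Summit.BirchSwinnertonDyer.Rank1Residual.Additive.CensusQ6
open Summit.BirchSwinnertonDyer.Rank1Residual.AdditivePotMult
open Summit.BirchSwinnertonDyer.BirchSwinnertonDyer.Theses.AdditiveBranchIMC
open Summit.BirchSwinnertonDyer.BirchSwinnertonDyer.Theorems.AdditiveBranchIMCMultLower

/-! ## §1 Item 19590 BY NAME from the record-and-budget row data -/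

/-- **Item 19590 `MultLambdaLower` BY NAME from Kato's half-eigen divisibility and ROW DATA.** IF every
cell-(M) pair `(E, p)` of analytic rank `≤ 1` EITHER is an X4(M) pair with `ρ̄_{E,p}` onto carrying, for some
index `b`, the RECORD (first unit coefficient of the branch series of the multiplicative twist model at `b`,
parity of `(p−1)/2`) and the BUDGET `b ≤ λ` (free for `b ≤ rank E(ℚ)`; else from a congruent partner, §4 /
n1011's `budgetLeLambdaAt_of_epw_of_partnerRank`), OR satisfies the Λ-adic input at its twist models outright,
THEN `MultLambdaLower`: on the first kind of row n1011's
`ClassX4M.forall_quadraticBranchLowerDivisibilityAt_of_katoHalf_of_firstUnitIndex_of_budget'` (Kato `λ ≤ b`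
+ budget `b ≤ λ` ⟹ equality of characteristic ideal and branch `L`-function). The hypothesis is NOT a
theorem (X3(M) rows, non-surjective irreducible rows, and rows without a certified budget have no door);
19590 stays OPEN; this records what a per-pair certificate buys. [cite: Kato2004Asterisque, Thm. 12.5 (4) (p. 222), Thm. 17.4 (3) (p. 273)]
[cite: EmertonPollackWeston2006, Cor. 3.2.5 and Thm. 3.1.1 (source of the typed budget)]
[cite: GreenbergLNM1716, §3 Lemma 3.1] [cite: SkinnerUrban2014, Thm. 3.6.4 (shape only)] -/
theorem multLambdaLower_of_katoHalf_of_rowData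
    (hKW : Wuthrich2014.kato_halfEigenCharIdeal_dvd_cyclotomicPrime_of_surjective)
    (hRows : ∀ (W : WeierstrassCurve ℚ) [W.IsElliptic] [W.IsGloballyMinimal] (p : ℕ) [Fact p.Prime],
      N10.CellM W p → W.analyticRank ≤ 1 →
      (ClassX4M W p ∧ Surj W p ∧ ∃ b : ℕ,
          ((p % 4 = 1 → MultFirstUnitIndexAt W p b) ∧ (p % 4 = 3 → MultOddFirstUnitIndexAt W p b)) ∧
            BudgetLeLambdaAt p W b) ∨
        ∀ (V : WeierstrassCurve ℚ) [V.IsElliptic] [V.IsGloballyMinimal],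
          (∃ C : VariableChange ℚ, C • V.quadraticTwist ((-1) ^ (p / 2) * p : ℚ) = W) →
            QuadraticBranchLowerDivisibilityAt V p) :
    MultLambdaLower := by
  intro W _ _ p _ hc hr V _ _ hCW
  rcases hRows W p hc hr with ⟨hX, hsurj, b, hrec, hbud⟩ | hraw
  · exact hX.forall_quadraticBranchLowerDivisibilityAt_of_katoHalf_of_firstUnitIndex_of_budget' hKW hsurj
      hrec hbud V hCW
  · exact hraw V hCW

/-! ## §2 The registered `stub_rankZero` (= `N10.LowerHalfM`) from the route's facts and row data -/

/-- **The rank-`0` half of crux 19359 (`stub_rankZero` = `N10.LowerHalfM` verbatim) from the route's facts,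
Kato's half-eigen divisibility, and ROW DATA on the CONTENT rows only** (`#Ш(E)_an` of positive `p`-adic
valuation whenever rational; the other rank-`0` rows close by `N10.missingLowerBoundAt_of_padicValRat_le_zero`):
EITHER (X4(M), `ρ̄` onto, record at `b`, budget `b ≤ λ`) — n1011's
`ClassX4M.missingLowerBoundAt_rankZero_of_katoHalf_of_firstUnitIndex_of_budget` — OR the raw Λ-adic input at
the twist models (gen 2's `missingLowerBoundAt_rankZero_of_cellM_of_quadraticBranchLower`). CONDITIONAL on
`hRows`; closes nothing. [cite: Kato2004Asterisque, Thm. 17.4 (3) (p. 273)] [cite: Delbourgo1998, Prop. 4 (p. 144), §2.2 Lemma (ii) (p. 139)]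
[cite: Pal2012, Thm. 3.2] [cite: EmertonPollackWeston2006, Cor. 3.2.5 and Thm. 3.1.1 (source of the typed budget)]
[cite: Miller2011LMS, Def. 1.1] -/
theorem lowerHalfM_of_facts_of_katoHalf_of_rowData
    (hDelX : Delbourgo1998.prop4_rankZero_constantCoeff_eq_unit_mul_of_potMult)
    (hPal : Pal2012.thm32_sqrt_mul_realPeriodRat_twist_eq_of_prime_one_mod_four)
    (hGZK : rank_eq_analyticRank_of_analyticRank_le_one) (hmod : hasEntireLFunction_rat)
    (hmodD : nonempty_modularParametrizationData)
    (hKW : Wuthrich2014.kato_halfEigenCharIdeal_dvd_cyclotomicPrime_of_surjective)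
    (hRows : ∀ (W : WeierstrassCurve ℚ) [W.IsElliptic] [W.IsGloballyMinimal] (p : ℕ) [Fact p.Prime],
      N10.CellM W p → W.analyticRank = 0 → (∀ q : ℚ, shaAn W = (q : ℂ) → 0 < padicValRat p q) →
      (ClassX4M W p ∧ Surj W p ∧ ∃ b : ℕ,
          ((p % 4 = 1 → MultFirstUnitIndexAt W p b) ∧ (p % 4 = 3 → MultOddFirstUnitIndexAt W p b)) ∧
            BudgetLeLambdaAt p W b) ∨
        ∀ (V : WeierstrassCurve ℚ) [V.IsElliptic] [V.IsGloballyMinimal],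
          (∃ C : VariableChange ℚ, C • V.quadraticTwist ((-1) ^ (p / 2) * p : ℚ) = W) →
            QuadraticBranchLowerDivisibilityAt V p) :
    N10.LowerHalfM := by
  intro W _ _ p _ hr hc
  by_cases hq : ∃ q : ℚ, shaAn W = (q : ℂ) ∧ padicValRat p q ≤ 0
  · obtain ⟨q, hq, hv⟩ := hq
    exact N10.missingLowerBoundAt_of_padicValRat_le_zero W p hq hv
  push Not at hq
  rcases hRows W p hc hr hq with ⟨hX, hsurj, b, hrec, hbud⟩ | hraw
  · exact hX.missingLowerBoundAt_rankZero_of_katoHalf_of_firstUnitIndex_of_budget hKW hDelX hPal hGZK hmod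
      hmodD hsurj hr hrec hbud
  · exact missingLowerBoundAt_rankZero_of_cellM_of_quadraticBranchLower hDelX hPal hGZK hmod hmodD hc hr hraw

/-! ## §3 The parent `MultLower` BY NAME from row data and the rank-`1` inputs -/

/-- **Crux 19359 `MultLower` BY NAME from the route's facts, Kato's half-eigen divisibility, the §1 row data
on every cell-(M) pair of analytic rank `≤ 1`, and the rank-`1` inputs of the §C split** (Schneider
non-degeneracy and the branch `p`-adic Gross–Zagier formula on (M), items 19591/19592, displayed as the binder
`hGZ`) — gen 2's crux shape `multLower_of_facts_of_quadraticBranchLower_of_branchPAdicGrossZagierMult` with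
its Λ-adic binder fed by §1. CONDITIONAL on `hRows` and `hGZ`; closes nothing.
[cite: Delbourgo1998, Main Conjecture (p. 151) (shape)] [cite: Delbourgo2002, Theorem (A), (B) (p. 40)]
[cite: Kato2004Asterisque, Thm. 17.4 (3) (p. 273)] [cite: Miller2011LMS, Def. 1.1] -/
theorem multLower_of_facts_of_katoHalf_of_rowData_of_rankOneInputs
    (hDelX : Delbourgo1998.prop4_rankZero_constantCoeff_eq_unit_mul_of_potMult)
    (hPal : Pal2012.thm32_sqrt_mul_realPeriodRat_twist_eq_of_prime_one_mod_four)
    (hDelM : Delbourgo2002.mainTheorem_potMult)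
    (hGZK : rank_eq_analyticRank_of_analyticRank_le_one) (hmod : hasEntireLFunction_rat)
    (hmodD : nonempty_modularParametrizationData)
    (hKW : Wuthrich2014.kato_halfEigenCharIdeal_dvd_cyclotomicPrime_of_surjective)
    (hRows : ∀ (W : WeierstrassCurve ℚ) [W.IsElliptic] [W.IsGloballyMinimal] (p : ℕ) [Fact p.Prime],
      N10.CellM W p → W.analyticRank ≤ 1 →
      (ClassX4M W p ∧ Surj W p ∧ ∃ b : ℕ,
          ((p % 4 = 1 → MultFirstUnitIndexAt W p b) ∧ (p % 4 = 3 → MultOddFirstUnitIndexAt W p b)) ∧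
            BudgetLeLambdaAt p W b) ∨
        ∀ (V : WeierstrassCurve ℚ) [V.IsElliptic] [V.IsGloballyMinimal],
          (∃ C : VariableChange ℚ, C • V.quadraticTwist ((-1) ^ (p / 2) * p : ℚ) = W) →
            QuadraticBranchLowerDivisibilityAt V p)
    (hGZ : ∀ (W : WeierstrassCurve ℚ) [W.IsElliptic] [W.IsGloballyMinimal] (p : ℕ) [Fact p.Prime],
      N10.CellM W p → W.analyticRank = 1 → ∀ Dh : PAdicHeightData W p, Delbourgo2002.LeadingTermClauses W p Dh →
        SchneiderConjecture Dh ∧ BranchPAdicGrossZagierMultAt W p Dh) :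
    MultLower :=
  multLower_of_facts_of_quadraticBranchLower_of_branchPAdicGrossZagierMult hDelX hPal hDelM hGZK hmod hmodD
    (fun W _ _ p _ hc hr V _ _ hCW =>
      multLambdaLower_of_katoHalf_of_rowData hKW hRows W p hc hr V hCW)
    hGZ

/-! ## §4 The EPW rank-partner supply of the budget, composed into 19359's currency -/

/-- **Cell (M) with `ρ̄_{E,p}` onto (X4(M)), `r_an(E) = 0`, EVERY odd `p`: the lower half
`ord_p #Ш(E)_an ≤ ord_p #Ш(E)` from the record at index `b` and a CONGRUENT PARTNER of enough rank** — the
route-K1 name for n1011's (M)–(M) end composed with the cited EPW algebraic transfer: partner `E₁ = W₁` in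
X4(M) with `ρ̄_{E₁,p}` onto and `r₁ ≤ rank E₁(ℚ)` (NO certificate at the partner: its cyclotomic dual data are
torsion with `μ = 0 ⟹ r₁ ≤ λ`, `ClassX4M.isTorsion_and_le_lambdaInvariant_of_katoHalf`); the place `v ∋ p`,
ramified ordinary lines `L`, `L₁` (Tate), a line-respecting `Γ_ℚ`-equivariant `E[p] ≃ E₁[p]`, a finite set
`Σ₀ ∌ p` outside which both are good, and `b ≤ r₁ + Σ_{w∈Σ₀} (δ(E₁,w) − δ(E,w))`. Then EPW 3.3.2/3.3.3 give
the budget (`budgetLeLambdaAt_of_epw_of_partnerRank`) and n1011's `…_of_budget` door the lower half. This is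
the instrument whose reach k1-c2 gen 3 measured (kit j253895). PER PAIR; CONDITIONAL on the displayed facts and
data; closes nothing by itself. [cite: EmertonPollackWeston2006, Thm. 3.3.2, Thm. 3.3.3 (2) (arXiv:math/0404484 p. 19) and Lemma 5.1.5 (p. 30)]
[cite: Kato2004Asterisque, Thm. 17.4 (3) (p. 273)] [cite: Delbourgo1998, Prop. 4 (p. 144)] [cite: Pal2012, Thm. 3.2]
[cite: GreenbergVatsal2000, §2 Prop. (2.4) (p. 22)] [cite: Miller2011LMS, Def. 1.1] -/
theorem missingLowerBoundAt_rankZero_cellM_surj_of_epw_of_multPartner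
    {W W₁ : WeierstrassCurve ℚ} [W.IsElliptic] [W.IsGloballyMinimal] [W₁.IsElliptic] [W₁.IsGloballyMinimal]
    {p : ℕ} [Fact p.Prime]
    (hKW : Wuthrich2014.kato_halfEigenCharIdeal_dvd_cyclotomicPrime_of_surjective)
    (hEPW : muLambdaAlg_transfer_of_torsionIso_potOrd)
    (hDelX : Delbourgo1998.prop4_rankZero_constantCoeff_eq_unit_mul_of_potMult)
    (hPal : Pal2012.thm32_sqrt_mul_realPeriodRat_twist_eq_of_prime_one_mod_four)
    (hGZK : rank_eq_analyticRank_of_analyticRank_le_one) (hmod : hasEntireLFunction_rat)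
    (hmodD : nonempty_modularParametrizationData)
    (hX : ClassX4M W p) (hsurj : Surj W p) (hr : W.analyticRank = 0) {b : ℕ}
    (hrec : (p % 4 = 1 → MultFirstUnitIndexAt W p b) ∧ (p % 4 = 3 → MultOddFirstUnitIndexAt W p b))
    (hX₁ : ClassX4M W₁ p) (hsurj₁ : Surj W₁ p) {r₁ : ℕ} (hr₁ : r₁ ≤ W₁.mordellWeilRank)
    {v : HeightOneSpectrum (𝓞 ℚ)} (hv : ((p : ℕ) : 𝓞 ℚ) ∈ v.asIdeal)
    {L : LocalDatum ℚ (W.geomPrimaryTorsion p) v} {L₁ : LocalDatum ℚ (W₁.geomPrimaryTorsion p) v}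
    (hL : IsRamifiedOrdinaryLine W p L) (hL₁ : IsRamifiedOrdinaryLine W₁ p L₁)
    (hiso : ∃ e : geomTorsion W (p : ℤ) ≃+ geomTorsion W₁ (p : ℤ),
      (∀ (σ : absoluteGaloisGroup ℚ) (P : geomTorsion W (p : ℤ)), e (σ • P) = σ • e P) ∧
      (∀ P : geomTorsion W (p : ℤ),
        AddSubgroup.inclusion (geomTorsion_le_geomPrimaryTorsion W p) P ∈ L.plus ↔
          AddSubgroup.inclusion (geomTorsion_le_geomPrimaryTorsion W₁ p) (e P) ∈ L₁.plus))
    (S₀ : Finset (HeightOneSpectrum (𝓞 ℚ))) (hS₀ : ∀ w ∈ S₀, ((p : ℕ) : 𝓞 ℚ) ∉ w.asIdeal)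
    (hS : ∀ w : HeightOneSpectrum (𝓞 ℚ), w ∉ S₀ → ((p : ℕ) : 𝓞 ℚ) ∉ w.asIdeal →
      W.HasGoodReductionAt w)
    (hS₁ : ∀ w : HeightOneSpectrum (𝓞 ℚ), w ∉ S₀ → ((p : ℕ) : 𝓞 ℚ) ∉ w.asIdeal →
      W₁.HasGoodReductionAt w)
    (hb : (b : ℤ) ≤ r₁ + ∑ w ∈ S₀, ((delta W₁ p w : ℤ) - (delta W p w : ℤ))) :
    MissingLowerBoundAt W p :=
  hX.missingLowerBoundAt_rankZero_of_katoHalf_of_firstUnitIndex_of_budget hKW hDelX hPal hGZK hmod hmodD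
    hsurj hr hrec
    (budgetLeLambdaAt_of_epw_of_partnerRank hEPW hX.p_ne_two hv hL hL₁ hX.irr hiso S₀ hS₀ hS hS₁
      (fun hκ hγ hγ' D₁ _ ↦ hX₁.isTorsion_and_le_lambdaInvariant_of_katoHalf hKW hmodD hsurj₁ hr₁ hκ hγ hγ' D₁)
      hb)

end Summit.BirchSwinnertonDyer.BirchSwinnertonDyer.Theorems.AdditiveBranchIMCMultLowerBudget

end
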